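import Mathlib
import Summits.ValiantsHypothesis.ValiantsHypothesis.Theorems.LacunarySymmetroidMatrixDescartesDoorA26WallBubblingExpNewton

/-!
# Exponential Newton inequalities — the CHORD / PARALLELOGRAM rule (equal-length chords have non-increasing slope)

Corollary module of the ENS theorem of record (`…WallBubblingExpNewtonBase` p645803, `…WallBubblingExpNewton` p646572) for the
line `Cruxes/DoorA26/Lines/wall_bubbling.lean` (stmt-ValiantsHypothesis-19979), (M)-instrument §2.4 item (E1) «equal-length chords of a
concave arrangement have non-increasing slope ⇒ W_bc·W_ac′ ≥ W_bc′·W_ac»: from weak concavity of EVERY triple of active classes,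
four active classes `a < b ≤ c < d` with `a + d = b + c` satisfy

  `log c_a + log c_d ≤ log c_b + log c_c`,  `c_y = |classSum y| · ∏_{y' ≠ y} |y − y'|`

(the two MIDDLE weights dominate the two EXTREME weights; for `b = c` this is the midpoint Newton inequality `c_a c_d ≤ c_b²`).
Robust form `robust_exp_newton_chord` (convergent families, frequently Descartes-saturated in a window — the form the sieve consumes)
and one-sum form `exp_newton_chord` (n − 1 distinct zeros).  Proof: add the triple inequalities for `(a,b,d)` and `(a,c,d)`; the
hypothesis `a + d = b + c` makes the coefficients of `log c_a`, `log c_d` collapse to `d − a`.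

USE (located, this seat's α-register note): for TORIC coefficient families (|coefficients| = monomials `q^M` in positive parameters, e.g.
the matching sums of the static tridiagonal register) the `q`-parts cancel on every parallelogram `M_a + M_d = M_b + M_c`, leaving a
parameter-free inequality between the gap products `W` — a finite obstruction to Descartes-sharpness.

HONEST FRAMING: elementary corollary of ENS; a helper of the (M) INSTRUMENT only — nothing here bears on `DoorA26` (OPEN; (W), (M), (R)
remain), on `MatrixDescartes` (18050) or on `VP ≠ VNP`.  Seat: prover val-sym-lift-p2 g17, `--supports stmt-ValiantsHypothesis-19979`.
-/

-- `Summit.ValiantsHypothesis.ValiantsHypothesis.…` repeats a component by the D-0017 layout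
-- (single-conjunct summit), which the `dupNamespace` linter flags; the name is mandated.
set_option linter.dupNamespace false

namespace Summit.ValiantsHypothesis.ValiantsHypothesis.Theorems.LacunarySymmetroidMatrixDescartes.WallBubbling.Bubbling

open Finset Filter Topology

variable {ι : Type*} [Fintype ι]

/-- Chord rule from triple concavity (pure inequality bookkeeping): if `f` is weakly concave on every triple of
`{a, b, c, d}` in the weighted sense, `a < b ≤ c < d` and `a + d = b + c`, then `f a + f d ≤ f b + f c`. [folklore] -/
theorem chord_of_triples {a b c d : ℝ} (f : ℝ → ℝ) (hab : a < b) (hbc : b ≤ c) (hcd : c < d) (hsum : a + d = b + c)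
    (h1 : (d - b) * f a + (b - a) * f d ≤ (d - a) * f b)
    (h2 : (d - c) * f a + (c - a) * f d ≤ (d - a) * f c) :
    f a + f d ≤ f b + f c := by
  have hda : 0 < d - a := by linarith
  have e1 : (b + c) * f a = (a + d) * f a := by rw [hsum]
  have e2 : (b + c) * f d = (a + d) * f d := by rw [hsum]
  have hsum' : (d - a) * (f a + f d) ≤ (d - a) * (f b + f c) := by linarith
  exact le_of_mul_le_mul_left hsum' hda

/-- **ROBUST ENS — CHORD / PARALLELOGRAM RULE.**  Along a coefficient/exponent-convergent family of real exponential sums that is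
frequently Descartes-saturated in a window (hypotheses of `robust_exp_newton`), four ACTIVE limit classes `a < b ≤ c < d` with
`a + d = b + c` satisfy `log c_a + log c_d ≤ log c_b + log c_c`, `c_y = |classSum a₀ x₀ y| · ∏_{y' ∈ V ∖ y} |y − y'|` — the two middle
weights dominate the two extreme ones ((M)-instrument item (E1)). [this work] -/
theorem robust_exp_newton_chord (a x : ℕ → ι → ℝ) (a₀ x₀ : ι → ℝ) (V : Finset ℝ)
    (ha : ∀ i, Tendsto (fun ν => a ν i) atTop (𝓝 (a₀ i)))
    (hx : ∀ i, Tendsto (fun ν => x ν i) atTop (𝓝 (x₀ i)))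
    (hV : ∀ w, classSum a₀ x₀ w ≠ 0 ↔ w ∈ V) (R : ℝ)
    (hsat : ∃ᶠ ν in atTop, ∃ Z : Finset ℝ,
      (∀ z ∈ Z, z ∈ Set.Icc (-R) R ∧ expSum (a ν) (x ν) z = 0) ∧ V.card ≤ Z.card + 1)
    {p q r s : ℝ} (hp : p ∈ V) (hq : q ∈ V) (hr : r ∈ V) (hs : s ∈ V)
    (hpq : p < q) (hqr : q ≤ r) (hrs : r < s) (hsum : p + s = q + r) :
    Real.log (|classSum a₀ x₀ p| * ∏ y ∈ V.erase p, |p - y|) +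
      Real.log (|classSum a₀ x₀ s| * ∏ y ∈ V.erase s, |s - y|) ≤
    Real.log (|classSum a₀ x₀ q| * ∏ y ∈ V.erase q, |q - y|) +
      Real.log (|classSum a₀ x₀ r| * ∏ y ∈ V.erase r, |r - y|) := by
  refine chord_of_triples (fun y => Real.log (|classSum a₀ x₀ y| * ∏ y' ∈ V.erase y, |y - y'|)) hpq hqr hrs hsum ?_ ?_
  · exact robust_exp_newton a x a₀ x₀ V ha hx hV R hsat hp hq hs hpq (lt_of_le_of_lt hqr hrs)
  · exact robust_exp_newton a x a₀ x₀ V ha hx hV R hsat hp hr hs (lt_of_lt_of_le hpq hqr) hrs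

/-- **ENS — CHORD / PARALLELOGRAM RULE (one sum, distinct zeros).**  If `expSum a₀ x₀` with active class set `V` has `#V − 1`
distinct real zeros, then four active classes `a < b ≤ c < d` with `a + d = b + c` satisfy `c_a · c_d ≤ c_b · c_c` in log form,
`c_y = |classSum y| · ∏_{y' ≠ y} |y − y'|`.  For TORIC coefficient families the coefficient parts cancel on parallelograms, leaving
a parameter-free inequality between gap products. [this work] -/
theorem exp_newton_chord (a₀ x₀ : ι → ℝ) (V : Finset ℝ) (hV : ∀ w, classSum a₀ x₀ w ≠ 0 ↔ w ∈ V)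
    (Z : Finset ℝ) (hZ : ∀ z ∈ Z, expSum a₀ x₀ z = 0) (hcard : V.card ≤ Z.card + 1)
    {p q r s : ℝ} (hp : p ∈ V) (hq : q ∈ V) (hr : r ∈ V) (hs : s ∈ V)
    (hpq : p < q) (hqr : q ≤ r) (hrs : r < s) (hsum : p + s = q + r) :
    Real.log (|classSum a₀ x₀ p| * ∏ y ∈ V.erase p, |p - y|) +
      Real.log (|classSum a₀ x₀ s| * ∏ y ∈ V.erase s, |s - y|) ≤
    Real.log (|classSum a₀ x₀ q| * ∏ y ∈ V.erase q, |q - y|) +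
      Real.log (|classSum a₀ x₀ r| * ∏ y ∈ V.erase r, |r - y|) := by
  refine chord_of_triples (fun y => Real.log (|classSum a₀ x₀ y| * ∏ y' ∈ V.erase y, |y - y'|)) hpq hqr hrs hsum ?_ ?_
  · exact exp_newton a₀ x₀ V hV Z hZ hcard hp hq hs hpq (lt_of_le_of_lt hqr hrs)
  · exact exp_newton a₀ x₀ V hV Z hZ hcard hp hr hs (lt_of_lt_of_le hpq hqr) hrs

/-- Product form of the chord rule: with all four weights positive, `c_a · c_d ≤ c_b · c_c`. [this work] -/
theorem exp_newton_chord_mul (a₀ x₀ : ι → ℝ) (V : Finset ℝ) (hV : ∀ w, classSum a₀ x₀ w ≠ 0 ↔ w ∈ V)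
    (Z : Finset ℝ) (hZ : ∀ z ∈ Z, expSum a₀ x₀ z = 0) (hcard : V.card ≤ Z.card + 1)
    {p q r s : ℝ} (hp : p ∈ V) (hq : q ∈ V) (hr : r ∈ V) (hs : s ∈ V)
    (hpq : p < q) (hqr : q ≤ r) (hrs : r < s) (hsum : p + s = q + r) :
    (|classSum a₀ x₀ p| * ∏ y ∈ V.erase p, |p - y|) * (|classSum a₀ x₀ s| * ∏ y ∈ V.erase s, |s - y|) ≤
      (|classSum a₀ x₀ q| * ∏ y ∈ V.erase q, |q - y|) * (|classSum a₀ x₀ r| * ∏ y ∈ V.erase r, |r - y|) := by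
  -- all weights are positive: active class sums are nonzero and `V` has distinct elements
  have hpos : ∀ y ∈ V, 0 < |classSum a₀ x₀ y| * ∏ y' ∈ V.erase y, |y - y'| := by
    intro y hy
    refine mul_pos (abs_pos.mpr ((hV y).mpr hy)) (Finset.prod_pos fun y' hy' => abs_pos.mpr (sub_ne_zero.mpr ?_))
    exact fun h => (Finset.mem_erase.mp hy').1 (h ▸ rfl)
  have h := exp_newton_chord a₀ x₀ V hV Z hZ hcard hp hq hr hs hpq hqr hrs hsum
  rw [← Real.log_mul (hpos p hp).ne' (hpos s hs).ne', ← Real.log_mul (hpos q hq).ne' (hpos r hr).ne'] at h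
  exact (Real.log_le_log_iff (mul_pos (hpos p hp) (hpos s hs)) (mul_pos (hpos q hq) (hpos r hr))).mp h

/-- **GAP-PRODUCT (FACE) RULE — the parameter-free shadow of ENS on a coefficient parallelogram.**  If, in addition, the four
absolute class sums satisfy `|A_p| · |A_s| = |A_q| · |A_r|` (automatic for TORIC coefficient families `|A_M| = q^M` on a parallelogram
`M_p + M_s = M_q + M_r`, and for the (M)-instrument's parallel null letters with `γ_bc = ρ·γ_ac`), then the coefficient parts cancel and
Descartes-sharpness forces the pure GAP-PRODUCT inequality `W_p · W_s ≤ W_q · W_r`, `W_y = ∏_{y' ≠ y} |y − y'|` — e.g. the α-register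
face rule `W_{A+k} W_{A+l} ≥ W_A W_{A+k+l}` (same-sign slopes) / `≤` (opposite signs). [this work] -/
theorem exp_newton_gapProduct (a₀ x₀ : ι → ℝ) (V : Finset ℝ) (hV : ∀ w, classSum a₀ x₀ w ≠ 0 ↔ w ∈ V)
    (Z : Finset ℝ) (hZ : ∀ z ∈ Z, expSum a₀ x₀ z = 0) (hcard : V.card ≤ Z.card + 1)
    {p q r s : ℝ} (hp : p ∈ V) (hq : q ∈ V) (hr : r ∈ V) (hs : s ∈ V)
    (hpq : p < q) (hqr : q ≤ r) (hrs : r < s) (hsum : p + s = q + r)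
    (hcoef : |classSum a₀ x₀ p| * |classSum a₀ x₀ s| = |classSum a₀ x₀ q| * |classSum a₀ x₀ r|) :
    (∏ y ∈ V.erase p, |p - y|) * (∏ y ∈ V.erase s, |s - y|) ≤ (∏ y ∈ V.erase q, |q - y|) * (∏ y ∈ V.erase r, |r - y|) := by
  have h := exp_newton_chord_mul a₀ x₀ V hV Z hZ hcard hp hq hr hs hpq hqr hrs hsum
  have hA : 0 < |classSum a₀ x₀ q| * |classSum a₀ x₀ r| :=
    mul_pos (abs_pos.mpr ((hV q).mpr hq)) (abs_pos.mpr ((hV r).mpr hr))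
  have h' : (|classSum a₀ x₀ q| * |classSum a₀ x₀ r|) * ((∏ y ∈ V.erase p, |p - y|) * ∏ y ∈ V.erase s, |s - y|) ≤
      (|classSum a₀ x₀ q| * |classSum a₀ x₀ r|) * ((∏ y ∈ V.erase q, |q - y|) * ∏ y ∈ V.erase r, |r - y|) := by
    calc (|classSum a₀ x₀ q| * |classSum a₀ x₀ r|) * ((∏ y ∈ V.erase p, |p - y|) * ∏ y ∈ V.erase s, |s - y|)
        = (|classSum a₀ x₀ p| * |classSum a₀ x₀ s|) * ((∏ y ∈ V.erase p, |p - y|) * ∏ y ∈ V.erase s, |s - y|) := by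
          rw [hcoef]
      _ = (|classSum a₀ x₀ p| * ∏ y ∈ V.erase p, |p - y|) * (|classSum a₀ x₀ s| * ∏ y ∈ V.erase s, |s - y|) := by ring
      _ ≤ (|classSum a₀ x₀ q| * ∏ y ∈ V.erase q, |q - y|) * (|classSum a₀ x₀ r| * ∏ y ∈ V.erase r, |r - y|) := h
      _ = (|classSum a₀ x₀ q| * |classSum a₀ x₀ r|) * ((∏ y ∈ V.erase q, |q - y|) * ∏ y ∈ V.erase r, |r - y|) := by ring
  exact le_of_mul_le_mul_left h' hA

/-! ## Index form: injective exponents on the active indices (the TORIC use) -/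

/-- With exponents injective on the ACTIVE indices (`a i ≠ 0`), the class of `x i` is the singleton `{i}`:
`classSum a x (x i) = a i`. [folklore] -/
theorem classSum_eq_of_injOn (a x : ι → ℝ) (hinj : ∀ i j, a i ≠ 0 → a j ≠ 0 → x i = x j → i = j)
    (i : ι) (hi : a i ≠ 0) : classSum a x (x i) = a i := by
  classical
  unfold classSum
  rw [Finset.sum_eq_single i]
  · rw [if_pos rfl]
  · intro j _ hji
    by_cases hj : a j = 0
    · simp [hj]
    · rw [if_neg]
      exact fun h => hji (hinj j i hj hi h)
  · exact fun h => absurd (Finset.mem_univ i) h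

/-- … and a value hit by no active index carries class sum `0`. [folklore] -/
theorem classSum_eq_zero_of_forall (a x : ι → ℝ) (w : ℝ) (hw : ∀ i, a i ≠ 0 → x i ≠ w) : classSum a x w = 0 := by
  unfold classSum
  refine Finset.sum_eq_zero fun i _ => ?_
  by_cases hi : a i = 0
  · simp [hi]
  · rw [if_neg (hw i hi)]

/-- **GAP-PRODUCT RULE, INDEX FORM (toric families).**  Let `expSum a x` have exponents injective on the active indices, let it
have `#active − 1` distinct real zeros (Descartes sharp), and let four active indices `i₀, i₁, i₂, i₃` form an exponent
PARALLELOGRAM `x i₀ + x i₃ = x i₁ + x i₂` with `x i₀ < x i₁ ≤ x i₂ < x i₃` and carry coefficients with `|a i₀|·|a i₃| = |a i₁|·|a i₂|`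
(automatic when `|a|` is a monomial in positive parameters).  Then the GAP PRODUCTS `W i = ∏_{j active, j ≠ i} |x i − x j|` satisfy
`W i₀ · W i₃ ≤ W i₁ · W i₂` — no coefficient appears.  (α-register use: `i₀ = A`, `i₃ = A ∪ {k,l}`, `{i₁,i₂} = {A ∪ {k}, A ∪ {l}}` for
same-sign slopes; the roles of extremes and middles swap for opposite signs.) [this work] -/
theorem exp_newton_gapProduct_index [DecidableEq ι] (a x : ι → ℝ)
    (hinj : ∀ i j, a i ≠ 0 → a j ≠ 0 → x i = x j → i = j)
    (Z : Finset ℝ) (hZ : ∀ z ∈ Z, expSum a x z = 0)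
    (hcard : (Finset.univ.filter fun i => a i ≠ 0).card ≤ Z.card + 1)
    {i₀ i₁ i₂ i₃ : ι} (h₀ : a i₀ ≠ 0) (h₁ : a i₁ ≠ 0) (h₂ : a i₂ ≠ 0) (h₃ : a i₃ ≠ 0)
    (h01 : x i₀ < x i₁) (h12 : x i₁ ≤ x i₂) (h23 : x i₂ < x i₃) (hsum : x i₀ + x i₃ = x i₁ + x i₂)
    (hcoef : |a i₀| * |a i₃| = |a i₁| * |a i₂|) :
    (∏ j ∈ (Finset.univ.filter fun j => a j ≠ 0).erase i₀, |x i₀ - x j|) *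
        (∏ j ∈ (Finset.univ.filter fun j => a j ≠ 0).erase i₃, |x i₃ - x j|) ≤
      (∏ j ∈ (Finset.univ.filter fun j => a j ≠ 0).erase i₁, |x i₁ - x j|) *
        (∏ j ∈ (Finset.univ.filter fun j => a j ≠ 0).erase i₂, |x i₂ - x j|) := by
  classical
  set Act : Finset ι := Finset.univ.filter fun j => a j ≠ 0 with hAct
  set V : Finset ℝ := Act.image x with hVdef
  have hmemAct : ∀ i, i ∈ Act ↔ a i ≠ 0 := fun i => by simp [hAct]
  have hinjOn : Set.InjOn x (Act : Set ι) := fun i hi j hj h =>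
    hinj i j ((hmemAct i).mp hi) ((hmemAct j).mp hj) h
  have hV : ∀ w, classSum a x w ≠ 0 ↔ w ∈ V := by
    intro w
    constructor
    · intro hw
      by_contra hmem
      apply hw
      refine classSum_eq_zero_of_forall a x w fun i hi h => hmem ?_
      exact Finset.mem_image.mpr ⟨i, (hmemAct i).mpr hi, h⟩
    · intro hw
      obtain ⟨i, hi, rfl⟩ := Finset.mem_image.mp hw
      rw [classSum_eq_of_injOn a x hinj i ((hmemAct i).mp hi)]
      exact (hmemAct i).mp hi
  have hcardV : V.card ≤ Z.card + 1 := by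
    rw [hVdef, Finset.card_image_of_injOn hinjOn]; exact hcard
  have hmemV : ∀ i, a i ≠ 0 → x i ∈ V := fun i hi => Finset.mem_image.mpr ⟨i, (hmemAct i).mpr hi, rfl⟩
  -- the class weights at `x i` are the index weights
  have hW : ∀ i, a i ≠ 0 → (∏ y ∈ V.erase (x i), |x i - y|) = ∏ j ∈ Act.erase i, |x i - x j| := by
    intro i hi
    have hiA : i ∈ Act := (hmemAct i).mpr hi
    have hset : V.erase (x i) = (Act.erase i).image x := by
      ext y
      simp only [Finset.mem_erase, hVdef, Finset.mem_image]
      constructor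
      · rintro ⟨hne, j, hj, rfl⟩
        exact ⟨j, ⟨fun hji => hne (by rw [hji]), hj⟩, rfl⟩
      · rintro ⟨j, ⟨hji, hj⟩, rfl⟩
        exact ⟨fun h => hji (hinjOn hj hiA h), j, hj, rfl⟩
    rw [hset, Finset.prod_image]
    intro j hj j' hj' h
    exact hinjOn (Finset.mem_of_mem_erase hj) (Finset.mem_of_mem_erase hj') h
  have key := exp_newton_gapProduct a x V hV Z hZ hcardV (hmemV _ h₀) (hmemV _ h₁) (hmemV _ h₂) (hmemV _ h₃)
    h01 h12 h23 hsum ?_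
  · rw [hW _ h₀, hW _ h₁, hW _ h₂, hW _ h₃] at key
    exact key
  · rw [classSum_eq_of_injOn a x hinj _ h₀, classSum_eq_of_injOn a x hinj _ h₁, classSum_eq_of_injOn a x hinj _ h₂,
      classSum_eq_of_injOn a x hinj _ h₃]
    exact hcoef

end Summit.ValiantsHypothesis.ValiantsHypothesis.Theorems.LacunarySymmetroidMatrixDescartes.WallBubbling.Bubbling
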